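import Literature.Geometry.DiscreteGeometry.LayerShellPatterns
import HarnessLib

/-!
# L2B, file 2: integer tables for the layer shells, and two finite facts about the cuboctahedron

HONEST FRAMING. Part of the venture `Summits/Ventures/Crystal3D` (cell `pub-crystal3d`, phase 2), a brick
of the radius-2 lemma `RadiusTwoBarlow` (`Bulk/PositionalOrder.lean`; design `HOME/lean/l2b/DESIGN.md`).
Elementary bookkeeping only: the twelve points of a layer shell `layerShell σ σ'` (`σ, σ' = ±1`) are the
combinations `(A/3) u₁ + (B/3) u₂ + (C/2) h e₃` listed by the TREE table `shellTable σ σ'`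
(`Literature/…/LayerShellPatterns.lean`), inner products are an integer quadratic form of the
coordinates, so finite statements about the two patterns become `decide` computations on integer
triples. No notation and no definition is declared (the hexagon table is written as a literal).

## Contents (namespace `Summit.Ventures.Crystal3D.L2B`)

* transport: `uveCombo_add/sub/neg`, `inner_uveCombo`, `uveCombo_inj`, `mem_hexagonSet_iff_table`,
  `mem_holeTriple_iff_table`, `mem_layerShell_iff_table`;
* `table_polarHexagon` / **`polar_add_hexagon_mem`** — «hexagon transfer»: in an HCP layer shell
  `layerShell s s`, for a polar point `x` (not in the hexagon) and a hexagon vector `η`, the point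
  `x + η` is a point of the shell, or `ζ + (a point of the shell)` for a hexagon point `ζ` at distance `2`
  from `x` — the fact behind «the centre's shell contains the hexagon parallel to the mirror plane of an
  HCP-type neighbour»;
* `table_cuboWitness` / **`cubo_witness`** — the «witness lemma» of the cuboctahedron
  `layerShell σ (−σ)`: for an inscribed regular hexagon `H′ = {±a, ±b, ±(a − b)}` other than the
  horizontal one, a polar point `p₀` and a point `q₀ ∉ H′`, there are `p` in the horizontal face through
  `p₀` and `q` in the `H′`-face through `q₀` with `⟪p, q⟫ = 0`, `q` horizontal and `p ∈ H′`.
-/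

noncomputable section

namespace Summit.Ventures.Crystal3D.L2B

open Literature.Geometry.DiscreteGeometry Literature.MathematicalPhysics.StatisticalMechanics
open RealInnerProductSpace

/-! ## Transport between the frame and integer coordinates -/

/-- `uveCombo` is additive. -/
theorem uveCombo_add (a b c a' b' c' : ℝ) :
    uveCombo a b c + uveCombo a' b' c' = uveCombo (a + a') (b + b') (c + c') := by
  simp only [uveCombo]; module

/-- `uveCombo` is subtractive. -/
theorem uveCombo_sub (a b c a' b' c' : ℝ) :
    uveCombo a b c - uveCombo a' b' c' = uveCombo (a - a') (b - b') (c - c') := by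
  simp only [uveCombo]; module

/-- `uveCombo` is odd. -/
theorem uveCombo_neg (a b c : ℝ) : -uveCombo a b c = uveCombo (-a) (-b) (-c) := by
  simp only [uveCombo]; module

/-- **Gram form.** `⟪α u₁ + β u₂ + γ h e₃, α′ u₁ + β′ u₂ + γ′ h e₃⟫ = 4αα′ + 2(αβ′ + βα′) + 4ββ′ + (8/3)γγ′`. -/
theorem inner_uveCombo (a b c a' b' c' : ℝ) :
    ⟪uveCombo a b c, uveCombo a' b' c'⟫ =
      4 * (a * a') + 2 * (a * b' + b * a') + 4 * (b * b') + 8 / 3 * (c * c') := by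
  simp only [uveCombo, inner_add_left, inner_add_right, real_inner_smul_left, real_inner_smul_right,
    inner_frameU_frameU, inner_frameU_frameV, inner_frameV_frameU, inner_frameV_frameV,
    inner_frameU_frameE, inner_frameE_frameU, inner_frameV_frameE, inner_frameE_frameV,
    inner_frameE_frameE]
  ring

/-- The coordinates of `uveCombo a b c` are `(2a + b, b√3, c h)`. -/
theorem uveCombo_apply (a b c : ℝ) :
    (uveCombo a b c) 0 = 2 * a + b ∧ (uveCombo a b c) 1 = b * Real.sqrt 3 ∧
      (uveCombo a b c) 2 = c * layerSpacing := by
  refine ⟨?_, ?_, ?_⟩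
  · simp [uveCombo]; ring
  · simp [uveCombo]
  · simp [uveCombo]

/-- `uveCombo` is injective (`u₁, u₂, h e₃` are linearly independent). -/
theorem uveCombo_inj {a b c a' b' c' : ℝ} (h : uveCombo a b c = uveCombo a' b' c') :
    a = a' ∧ b = b' ∧ c = c' := by
  obtain ⟨h0, h1, h2⟩ := uveCombo_apply a b c
  obtain ⟨h0', h1', h2'⟩ := uveCombo_apply a' b' c'
  rw [h] at h0 h1 h2
  have hs : (0 : ℝ) < Real.sqrt 3 := Real.sqrt_pos.2 (by norm_num)
  have hb : b = b' := by
    have := h1.symm.trans h1'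
    exact mul_right_cancel₀ hs.ne' this
  refine ⟨by linarith [h0.symm.trans h0'], hb, ?_⟩
  have := h2.symm.trans h2'
  exact mul_right_cancel₀ layerSpacing_pos.ne' this

/-- The standard hexagon in integer coordinates `(3α, 3β, 2γ)`. -/
theorem mem_hexagonSet_iff_table {x : EuclideanSpace ℝ (Fin 3)} :
    x ∈ hexagonSet ↔ ∃ t ∈ ({((3 : ℤ), (0 : ℤ), (0 : ℤ)), (-3, 0, 0), (0, 3, 0), (0, -3, 0), (3, -3, 0),
      (-3, 3, 0)} : Finset (ℤ × ℤ × ℤ)),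
      x = uveCombo ((t.1 : ℝ) / 3) ((t.2.1 : ℝ) / 3) ((t.2.2 : ℝ) / 2) := by
  simp only [hexagonSet, Set.mem_insert_iff, Set.mem_singleton_iff, Finset.mem_insert,
    Finset.mem_singleton, exists_eq_or_imp, exists_eq_left, uveCombo]
  push_cast
  simp only [show ((3 : ℝ) / 3) = 1 by norm_num, show ((-3 : ℝ) / 3) = -1 by norm_num,
    show ((0 : ℝ) / 3) = 0 by norm_num, show ((0 : ℝ) / 2) = 0 by norm_num, one_smul, zero_smul,
    neg_smul, add_zero, zero_add]
  constructor
  · rintro (rfl | rfl | rfl | rfl | rfl | rfl)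
    · exact Or.inl rfl
    · exact Or.inr (Or.inl rfl)
    · exact Or.inr (Or.inr (Or.inl rfl))
    · exact Or.inr (Or.inr (Or.inr (Or.inl rfl)))
    · exact Or.inr (Or.inr (Or.inr (Or.inr (Or.inl (by abel)))))
    · exact Or.inr (Or.inr (Or.inr (Or.inr (Or.inr (by abel)))))
  · rintro (rfl | rfl | rfl | rfl | rfl | rfl)
    · exact Or.inl rfl
    · exact Or.inr (Or.inl rfl)
    · exact Or.inr (Or.inr (Or.inl rfl))
    · exact Or.inr (Or.inr (Or.inr (Or.inl rfl)))
    · exact Or.inr (Or.inr (Or.inr (Or.inr (Or.inl (by abel)))))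
    · exact Or.inr (Or.inr (Or.inr (Or.inr (Or.inr (by abel)))))

/-- Table coordinates: `uve t = (t₁/3) u₁ + (t₂/3) u₂ + (t₃/2) h e₃` is additive in the integer triple. -/
theorem uveCombo_table_add (t t' : ℤ × ℤ × ℤ) :
    uveCombo (((t + t').1 : ℝ) / 3) (((t + t').2.1 : ℝ) / 3) (((t + t').2.2 : ℝ) / 2) =
      uveCombo ((t.1 : ℝ) / 3) ((t.2.1 : ℝ) / 3) ((t.2.2 : ℝ) / 2) +
        uveCombo ((t'.1 : ℝ) / 3) ((t'.2.1 : ℝ) / 3) ((t'.2.2 : ℝ) / 2) := by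
  rw [uveCombo_add]
  simp only [Prod.fst_add, Prod.snd_add, Int.cast_add]
  congr 1 <;> ring

/-- Table coordinates: subtraction. -/
theorem uveCombo_table_sub (t t' : ℤ × ℤ × ℤ) :
    uveCombo (((t - t').1 : ℝ) / 3) (((t - t').2.1 : ℝ) / 3) (((t - t').2.2 : ℝ) / 2) =
      uveCombo ((t.1 : ℝ) / 3) ((t.2.1 : ℝ) / 3) ((t.2.2 : ℝ) / 2) -
        uveCombo ((t'.1 : ℝ) / 3) ((t'.2.1 : ℝ) / 3) ((t'.2.2 : ℝ) / 2) := by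
  rw [uveCombo_sub]
  simp only [Prod.fst_sub, Prod.snd_sub, Int.cast_sub]
  congr 1 <;> ring

/-- Table coordinates: negation. -/
theorem uveCombo_table_neg (t : ℤ × ℤ × ℤ) :
    uveCombo (((-t).1 : ℝ) / 3) (((-t).2.1 : ℝ) / 3) (((-t).2.2 : ℝ) / 2) =
      -uveCombo ((t.1 : ℝ) / 3) ((t.2.1 : ℝ) / 3) ((t.2.2 : ℝ) / 2) := by
  rw [uveCombo_neg]
  simp only [Prod.fst_neg, Prod.snd_neg, Int.cast_neg]
  congr 1 <;> ring

/-- **Gram form in table coordinates**: `9 ⟪uve t, uve t′⟫ = 4 t₁t′₁ + 2 (t₁t′₂ + t₂t′₁) + 4 t₂t′₂ + 6 t₃t′₃`. -/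
theorem inner_uveCombo_table (t t' : ℤ × ℤ × ℤ) :
    ⟪uveCombo ((t.1 : ℝ) / 3) ((t.2.1 : ℝ) / 3) ((t.2.2 : ℝ) / 2),
      uveCombo ((t'.1 : ℝ) / 3) ((t'.2.1 : ℝ) / 3) ((t'.2.2 : ℝ) / 2)⟫ =
      ((4 * (t.1 * t'.1) + 2 * (t.1 * t'.2.1 + t.2.1 * t'.1) + 4 * (t.2.1 * t'.2.1) +
        6 * (t.2.2 * t'.2.2) : ℤ) : ℝ) / 9 := by
  rw [inner_uveCombo]; push_cast; ring

/-- Table coordinates are injective. -/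
theorem uveCombo_table_inj {t t' : ℤ × ℤ × ℤ}
    (h : uveCombo ((t.1 : ℝ) / 3) ((t.2.1 : ℝ) / 3) ((t.2.2 : ℝ) / 2) =
      uveCombo ((t'.1 : ℝ) / 3) ((t'.2.1 : ℝ) / 3) ((t'.2.2 : ℝ) / 2)) : t = t' := by
  obtain ⟨h1, h2, h3⟩ := uveCombo_inj h
  have e1 : t.1 = t'.1 := by exact_mod_cast (by linarith : (t.1 : ℝ) = t'.1)
  have e2 : t.2.1 = t'.2.1 := by exact_mod_cast (by linarith : (t.2.1 : ℝ) = t'.2.1)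
  have e3 : t.2.2 = t'.2.2 := by exact_mod_cast (by linarith : (t.2.2 : ℝ) = t'.2.2)
  exact Prod.ext e1 (Prod.ext e2 e3)

/-- **The layer shell is the image of the shell table** (`σ, σ' = ±1`). -/
theorem layerShell_eq_image_table {σ σ' : ℤ} (hσ : σ = 1 ∨ σ = -1) (hσ' : σ' = 1 ∨ σ' = -1) :
    layerShell (σ : ℝ) (σ' : ℝ) =
      (fun t : ℤ × ℤ × ℤ => uveCombo ((t.1 : ℝ) / 3) ((t.2.1 : ℝ) / 3) ((t.2.2 : ℝ) / 2)) ''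
        (shellTable σ σ' : Set (ℤ × ℤ × ℤ)) := by
  have hsub : (fun t : ℤ × ℤ × ℤ => uveCombo ((t.1 : ℝ) / 3) ((t.2.1 : ℝ) / 3) ((t.2.2 : ℝ) / 2)) ''
      (shellTable σ σ' : Set (ℤ × ℤ × ℤ)) ⊆ layerShell (σ : ℝ) (σ' : ℝ) := by
    rintro x ⟨⟨A, B, C⟩, ht, rfl⟩
    exact uveCombo_mem_layerShell ht
  have hinj : Function.Injective
      (fun t : ℤ × ℤ × ℤ => uveCombo ((t.1 : ℝ) / 3) ((t.2.1 : ℝ) / 3) ((t.2.2 : ℝ) / 2)) :=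
    fun t t' h => uveCombo_table_inj h
  have hcard : (shellTable σ σ').card = 12 := by
    rcases hσ with rfl | rfl <;> rcases hσ' with rfl | rfl <;> decide
  have hσr : (σ : ℝ) = 1 ∨ (σ : ℝ) = -1 := by
    rcases hσ with rfl | rfl <;> simp
  have hσr' : (σ' : ℝ) = 1 ∨ (σ' : ℝ) = -1 := by
    rcases hσ' with rfl | rfl <;> simp
  refine (Set.eq_of_subset_of_ncard_le hsub ?_ (finite_layerShell _ _)).symm
  rw [ncard_layerShell hσr hσr', Set.ncard_image_of_injective _ hinj, Set.ncard_coe_finset, hcard]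

/-- Membership in a layer shell, in table form. -/
theorem mem_layerShell_iff_table {σ σ' : ℤ} (hσ : σ = 1 ∨ σ = -1) (hσ' : σ' = 1 ∨ σ' = -1)
    {x : EuclideanSpace ℝ (Fin 3)} :
    x ∈ layerShell (σ : ℝ) (σ' : ℝ) ↔
      ∃ t ∈ shellTable σ σ', x = uveCombo ((t.1 : ℝ) / 3) ((t.2.1 : ℝ) / 3) ((t.2.2 : ℝ) / 2) := by
  rw [layerShell_eq_image_table hσ hσ']
  simp only [Set.mem_image, Finset.mem_coe, eq_comm]

/-! ## Hexagon transfer (HCP layer shells) -/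

/-- The finite fact behind `polar_add_hexagon_mem`, on the integer tables (by `decide`). -/
theorem table_polarHexagon : ∀ s ∈ signSet, ∀ x ∈ shellTable s s,
    x ∉ ({((3 : ℤ), (0 : ℤ), (0 : ℤ)), (-3, 0, 0), (0, 3, 0), (0, -3, 0), (3, -3, 0), (-3, 3, 0)} :
      Finset (ℤ × ℤ × ℤ)) →
    ∀ η ∈ ({((3 : ℤ), (0 : ℤ), (0 : ℤ)), (-3, 0, 0), (0, 3, 0), (0, -3, 0), (3, -3, 0), (-3, 3, 0)} :
      Finset (ℤ × ℤ × ℤ)),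
      x + η ∈ shellTable s s ∨
        ∃ ζ ∈ ({((3 : ℤ), (0 : ℤ), (0 : ℤ)), (-3, 0, 0), (0, 3, 0), (0, -3, 0), (3, -3, 0), (-3, 3, 0)} :
          Finset (ℤ × ℤ × ℤ)),
          4 * ((ζ - x).1 * (ζ - x).1) + 2 * ((ζ - x).1 * (ζ - x).2.1 + (ζ - x).2.1 * (ζ - x).1) +
              4 * ((ζ - x).2.1 * (ζ - x).2.1) + 6 * ((ζ - x).2.2 * (ζ - x).2.2) = 36 ∧
            x + η - ζ ∈ shellTable s s := by
  decide

/-- **Hexagon transfer.** In an HCP layer shell `layerShell s s` (`s = ±1`): for a polar point `x` (a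
point of the shell outside the hexagon) and a hexagon vector `η`, either `x + η` is again a point of the
shell, or there is a hexagon point `ζ` at distance `2` from `x` such that `x + η − ζ` is a point of the
shell. -/
theorem polar_add_hexagon_mem {s : ℝ} (hs : s = 1 ∨ s = -1) {x η : EuclideanSpace ℝ (Fin 3)}
    (hx : x ∈ layerShell s s) (hxH : x ∉ hexagonSet) (hη : η ∈ hexagonSet) :
    x + η ∈ layerShell s s ∨
      ∃ ζ ∈ hexagonSet, ⟪ζ - x, ζ - x⟫ = 4 ∧ x + η - ζ ∈ layerShell s s := by
  obtain ⟨s₀, hs₀, rfl⟩ : ∃ s₀ : ℤ, (s₀ = 1 ∨ s₀ = -1) ∧ (s₀ : ℝ) = s := by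
    rcases hs with rfl | rfl
    · exact ⟨1, Or.inl rfl, by simp⟩
    · exact ⟨-1, Or.inr rfl, by simp⟩
  obtain ⟨tx, htx, rfl⟩ := (mem_layerShell_iff_table hs₀ hs₀).1 hx
  obtain ⟨tη, htη, rfl⟩ := mem_hexagonSet_iff_table.1 hη
  have htxH : tx ∉ ({((3 : ℤ), (0 : ℤ), (0 : ℤ)), (-3, 0, 0), (0, 3, 0), (0, -3, 0), (3, -3, 0),
      (-3, 3, 0)} : Finset (ℤ × ℤ × ℤ)) :=
    fun h => hxH (mem_hexagonSet_iff_table.2 ⟨tx, h, rfl⟩)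
  rcases table_polarHexagon s₀ (mem_signSet hs₀) tx htx htxH tη htη with h | ⟨tζ, htζ, hG, hmem⟩
  · left
    rw [← uveCombo_table_add]
    exact (mem_layerShell_iff_table hs₀ hs₀).2 ⟨_, h, rfl⟩
  · right
    refine ⟨_, mem_hexagonSet_iff_table.2 ⟨tζ, htζ, rfl⟩, ?_, ?_⟩
    · rw [← uveCombo_table_sub, inner_uveCombo_table, hG]; norm_num
    · rw [← uveCombo_table_add, ← uveCombo_table_sub]
      exact (mem_layerShell_iff_table hs₀ hs₀).2 ⟨_, hmem, rfl⟩

/-! ## Table membership helpers -/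

/-- A table point of a layer shell lies in the shell table. -/
theorem table_mem_of_uve_mem {σ σ' : ℤ} (hσ : σ = 1 ∨ σ = -1) (hσ' : σ' = 1 ∨ σ' = -1)
    {t : ℤ × ℤ × ℤ}
    (h : uveCombo ((t.1 : ℝ) / 3) ((t.2.1 : ℝ) / 3) ((t.2.2 : ℝ) / 2) ∈ layerShell (σ : ℝ) (σ' : ℝ)) :
    t ∈ shellTable σ σ' := by
  obtain ⟨t', ht', he⟩ := (mem_layerShell_iff_table hσ hσ').1 h
  rwa [uveCombo_table_inj he]

/-- A table point of the hexagon lies in the hexagon table. -/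
theorem hexTable_mem_of_uve_mem {t : ℤ × ℤ × ℤ}
    (h : uveCombo ((t.1 : ℝ) / 3) ((t.2.1 : ℝ) / 3) ((t.2.2 : ℝ) / 2) ∈ hexagonSet) :
    t ∈ ({((3 : ℤ), (0 : ℤ), (0 : ℤ)), (-3, 0, 0), (0, 3, 0), (0, -3, 0), (3, -3, 0), (-3, 3, 0)} :
      Finset (ℤ × ℤ × ℤ)) := by
  obtain ⟨t', ht', he⟩ := mem_hexagonSet_iff_table.1 h
  rwa [uveCombo_table_inj he]

/-! ## The witness lemma of the cuboctahedron -/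

set_option synthInstance.maxSize 4096 in
set_option synthInstance.maxHeartbeats 400000 in
set_option maxHeartbeats 4000000 in
/-- The finite fact behind `cubo_witness`, on the integer tables (by `decide`): in the cuboctahedron
table `shellTable σ (−σ)`, for every inscribed regular hexagon `H′ = {±a, ±b, ±(a − b)}` (`⟪a, b⟫ = 2`,
i.e. Gram value `18`) that is not the horizontal one, every polar `p₀` and every `q₀ ∉ H′`, there are
`p` in the horizontal face through `p₀` and `q` in the `H′`-face through `q₀` with `⟪p, q⟫ = 0`,
`q` horizontal, `p ∈ H′`. -/
theorem table_cuboWitness : ∀ σ ∈ signSet, ∀ a ∈ shellTable σ (-σ), ∀ b ∈ shellTable σ (-σ),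
    4 * (a.1 * b.1) + 2 * (a.1 * b.2.1 + a.2.1 * b.1) + 4 * (a.2.1 * b.2.1) + 6 * (a.2.2 * b.2.2) = 18 →
    (∀ h ∈ [a, -a, b, -b, a - b, b - a], h ∈ shellTable σ (-σ)) →
    (∃ h ∈ [a, -a, b, -b, a - b, b - a], h ∉ ({((3 : ℤ), (0 : ℤ), (0 : ℤ)), (-3, 0, 0), (0, 3, 0),
      (0, -3, 0), (3, -3, 0), (-3, 3, 0)} : Finset (ℤ × ℤ × ℤ))) →
    ∀ p₀ ∈ shellTable σ (-σ), p₀ ∉ ({((3 : ℤ), (0 : ℤ), (0 : ℤ)), (-3, 0, 0), (0, 3, 0), (0, -3, 0),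
      (3, -3, 0), (-3, 3, 0)} : Finset (ℤ × ℤ × ℤ)) →
    ∀ q₀ ∈ shellTable σ (-σ), q₀ ∉ [a, -a, b, -b, a - b, b - a] →
    ∃ p ∈ shellTable σ (-σ), ∃ q ∈ shellTable σ (-σ),
      p - p₀ ∈ ({((0 : ℤ), (0 : ℤ), (0 : ℤ)), (3, 0, 0), (-3, 0, 0), (0, 3, 0), (0, -3, 0), (3, -3, 0),
        (-3, 3, 0)} : Finset (ℤ × ℤ × ℤ)) ∧
      q - q₀ ∈ [0, a, -a, b, -b, a - b, b - a] ∧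
      4 * (p.1 * q.1) + 2 * (p.1 * q.2.1 + p.2.1 * q.1) + 4 * (p.2.1 * q.2.1) + 6 * (p.2.2 * q.2.2) = 0 ∧
      q ∈ ({((3 : ℤ), (0 : ℤ), (0 : ℤ)), (-3, 0, 0), (0, 3, 0), (0, -3, 0), (3, -3, 0), (-3, 3, 0)} :
        Finset (ℤ × ℤ × ℤ)) ∧
      p ∈ [a, -a, b, -b, a - b, b - a] := by
  decide

/-- **The witness lemma of the cuboctahedron.** In the cuboctahedron `C = layerShell σ (−σ)`
(`σ = ±1`): let `H′ = {±a, ±b, ±(a − b)} ⊆ C` be an inscribed regular hexagon (`⟪a, b⟫ = 2`) other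
than the horizontal hexagon, `p₀ ∈ C` polar (not horizontal) and `q₀ ∈ C ∖ H′`. Then there are `p, q ∈ C`
with `p` in the horizontal face through `p₀` (`p = p₀` or `p − p₀` horizontal), `q` in the `H′`-face
through `q₀` (`q = q₀` or `q − q₀ ∈ H′`), `⟪p, q⟫ = 0`, `q` horizontal and `p ∈ H′`. -/
theorem cubo_witness {σ : ℝ} (hσ : σ = 1 ∨ σ = -1) {a b p₀ q₀ : EuclideanSpace ℝ (Fin 3)}
    (ha : a ∈ layerShell σ (-σ)) (hb : b ∈ layerShell σ (-σ)) (hab : ⟪a, b⟫ = 2)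
    (hH : ({a, -a, b, -b, a - b, b - a} : Set (EuclideanSpace ℝ (Fin 3))) ⊆ layerShell σ (-σ))
    (htilt : ¬ ({a, -a, b, -b, a - b, b - a} : Set (EuclideanSpace ℝ (Fin 3))) ⊆ hexagonSet)
    (hp₀ : p₀ ∈ layerShell σ (-σ)) (hp₀H : p₀ ∉ hexagonSet) (hq₀ : q₀ ∈ layerShell σ (-σ))
    (hq₀H : q₀ ∉ ({a, -a, b, -b, a - b, b - a} : Set (EuclideanSpace ℝ (Fin 3)))) :
    ∃ p ∈ layerShell σ (-σ), ∃ q ∈ layerShell σ (-σ),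
      (p = p₀ ∨ p - p₀ ∈ hexagonSet) ∧
      (q = q₀ ∨ q - q₀ ∈ ({a, -a, b, -b, a - b, b - a} : Set (EuclideanSpace ℝ (Fin 3)))) ∧
      ⟪p, q⟫ = 0 ∧ q ∈ hexagonSet ∧ p ∈ ({a, -a, b, -b, a - b, b - a} : Set (EuclideanSpace ℝ (Fin 3))) := by
  -- integer sign and tables
  obtain ⟨s₀, hs₀, rfl⟩ : ∃ s₀ : ℤ, (s₀ = 1 ∨ s₀ = -1) ∧ (s₀ : ℝ) = σ := by
    rcases hσ with rfl | rfl
    · exact ⟨1, Or.inl rfl, by simp⟩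
    · exact ⟨-1, Or.inr rfl, by simp⟩
  have hs₀' : (-s₀ = 1 ∨ -s₀ = -1) := by rcases hs₀ with rfl | rfl <;> simp
  have hcast : (-(s₀ : ℝ)) = ((-s₀ : ℤ) : ℝ) := by push_cast; ring
  rw [hcast] at ha hb hH hp₀ hq₀ ⊢
  obtain ⟨ta, hta, rfl⟩ := (mem_layerShell_iff_table hs₀ hs₀').1 ha
  obtain ⟨tb, htb, rfl⟩ := (mem_layerShell_iff_table hs₀ hs₀').1 hb
  obtain ⟨tp, htp, rfl⟩ := (mem_layerShell_iff_table hs₀ hs₀').1 hp₀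
  obtain ⟨tq, htq, rfl⟩ := (mem_layerShell_iff_table hs₀ hs₀').1 hq₀
  -- notation-free abbreviation of the table map, by a local equation lemma
  have six_eq : ∀ t : ℤ × ℤ × ℤ,
      (uveCombo ((t.1 : ℝ) / 3) ((t.2.1 : ℝ) / 3) ((t.2.2 : ℝ) / 2) ∈
        ({uveCombo ((ta.1 : ℝ) / 3) ((ta.2.1 : ℝ) / 3) ((ta.2.2 : ℝ) / 2),
          -uveCombo ((ta.1 : ℝ) / 3) ((ta.2.1 : ℝ) / 3) ((ta.2.2 : ℝ) / 2),
          uveCombo ((tb.1 : ℝ) / 3) ((tb.2.1 : ℝ) / 3) ((tb.2.2 : ℝ) / 2),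
          -uveCombo ((tb.1 : ℝ) / 3) ((tb.2.1 : ℝ) / 3) ((tb.2.2 : ℝ) / 2),
          uveCombo ((ta.1 : ℝ) / 3) ((ta.2.1 : ℝ) / 3) ((ta.2.2 : ℝ) / 2) -
            uveCombo ((tb.1 : ℝ) / 3) ((tb.2.1 : ℝ) / 3) ((tb.2.2 : ℝ) / 2),
          uveCombo ((tb.1 : ℝ) / 3) ((tb.2.1 : ℝ) / 3) ((tb.2.2 : ℝ) / 2) -
            uveCombo ((ta.1 : ℝ) / 3) ((ta.2.1 : ℝ) / 3) ((ta.2.2 : ℝ) / 2)} :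
          Set (EuclideanSpace ℝ (Fin 3)))) ↔ t ∈ [ta, -ta, tb, -tb, ta - tb, tb - ta] := by
    intro t
    rw [← uveCombo_table_neg, ← uveCombo_table_neg, ← uveCombo_table_sub, ← uveCombo_table_sub]
    simp only [Set.mem_insert_iff, Set.mem_singleton_iff, List.mem_cons, List.not_mem_nil, or_false]
    constructor
    · rintro (h | h | h | h | h | h)
      · exact Or.inl (uveCombo_table_inj h)
      · exact Or.inr (Or.inl (uveCombo_table_inj h))
      · exact Or.inr (Or.inr (Or.inl (uveCombo_table_inj h)))
      · exact Or.inr (Or.inr (Or.inr (Or.inl (uveCombo_table_inj h))))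
      · exact Or.inr (Or.inr (Or.inr (Or.inr (Or.inl (uveCombo_table_inj h)))))
      · exact Or.inr (Or.inr (Or.inr (Or.inr (Or.inr (uveCombo_table_inj h)))))
    · rintro (rfl | rfl | rfl | rfl | rfl | rfl)
      · exact Or.inl rfl
      · exact Or.inr (Or.inl rfl)
      · exact Or.inr (Or.inr (Or.inl rfl))
      · exact Or.inr (Or.inr (Or.inr (Or.inl rfl)))
      · exact Or.inr (Or.inr (Or.inr (Or.inr (Or.inl rfl))))
      · exact Or.inr (Or.inr (Or.inr (Or.inr (Or.inr rfl))))
  -- hypotheses in table form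
  have hG : 4 * (ta.1 * tb.1) + 2 * (ta.1 * tb.2.1 + ta.2.1 * tb.1) + 4 * (ta.2.1 * tb.2.1) +
      6 * (ta.2.2 * tb.2.2) = 18 := by
    have h := hab
    rw [inner_uveCombo_table] at h
    have : ((4 * (ta.1 * tb.1) + 2 * (ta.1 * tb.2.1 + ta.2.1 * tb.1) + 4 * (ta.2.1 * tb.2.1) +
        6 * (ta.2.2 * tb.2.2) : ℤ) : ℝ) = 18 := by linarith
    exact_mod_cast this
  have hH' : ∀ h ∈ [ta, -ta, tb, -tb, ta - tb, tb - ta], h ∈ shellTable s₀ (-s₀) := by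
    intro t ht
    exact table_mem_of_uve_mem hs₀ hs₀' (hH ((six_eq t).2 ht))
  have htilt' : ∃ h ∈ [ta, -ta, tb, -tb, ta - tb, tb - ta],
      h ∉ ({((3 : ℤ), (0 : ℤ), (0 : ℤ)), (-3, 0, 0), (0, 3, 0), (0, -3, 0), (3, -3, 0), (-3, 3, 0)} :
        Finset (ℤ × ℤ × ℤ)) := by
    by_contra hcon
    push Not at hcon
    apply htilt
    intro y hy
    -- every element of the six-set is a table point
    have : ∃ t ∈ [ta, -ta, tb, -tb, ta - tb, tb - ta],
        y = uveCombo ((t.1 : ℝ) / 3) ((t.2.1 : ℝ) / 3) ((t.2.2 : ℝ) / 2) := by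
      rw [← uveCombo_table_neg, ← uveCombo_table_neg, ← uveCombo_table_sub, ← uveCombo_table_sub] at hy
      simp only [Set.mem_insert_iff, Set.mem_singleton_iff] at hy
      rcases hy with rfl | rfl | rfl | rfl | rfl | rfl
      · exact ⟨ta, by simp, rfl⟩
      · exact ⟨-ta, by simp, rfl⟩
      · exact ⟨tb, by simp, rfl⟩
      · exact ⟨-tb, by simp, rfl⟩
      · exact ⟨ta - tb, by simp, rfl⟩
      · exact ⟨tb - ta, by simp, rfl⟩
    obtain ⟨t, ht, rfl⟩ := this
    exact mem_hexagonSet_iff_table.2 ⟨t, hcon t ht, rfl⟩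
  have htp' : tp ∉ ({((3 : ℤ), (0 : ℤ), (0 : ℤ)), (-3, 0, 0), (0, 3, 0), (0, -3, 0), (3, -3, 0),
      (-3, 3, 0)} : Finset (ℤ × ℤ × ℤ)) :=
    fun h => hp₀H (mem_hexagonSet_iff_table.2 ⟨tp, h, rfl⟩)
  have htq' : tq ∉ [ta, -ta, tb, -tb, ta - tb, tb - ta] := fun h => hq₀H ((six_eq tq).2 h)
  -- the finite fact
  obtain ⟨p, hp, q, hq, h1, h2, h3, h4, h5⟩ :=
    table_cuboWitness s₀ (mem_signSet hs₀) ta hta tb htb hG hH' htilt' tp htp htp' tq htq htq'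
  refine ⟨_, (mem_layerShell_iff_table hs₀ hs₀').2 ⟨p, hp, rfl⟩,
    _, (mem_layerShell_iff_table hs₀ hs₀').2 ⟨q, hq, rfl⟩, ?_, ?_, ?_, ?_, ?_⟩
  · rw [Finset.mem_insert] at h1
    rcases h1 with h1 | h1
    · exact Or.inl (by rw [sub_eq_zero.1 h1])
    · right; rw [← uveCombo_table_sub p tp]
      exact mem_hexagonSet_iff_table.2 ⟨_, h1, rfl⟩
  · rw [List.mem_cons] at h2
    rcases h2 with h2 | h2
    · exact Or.inl (by rw [sub_eq_zero.1 h2])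
    · right; rw [← uveCombo_table_sub q tq]; exact (six_eq _).2 h2
  · rw [inner_uveCombo_table, h3]; norm_num
  · exact mem_hexagonSet_iff_table.2 ⟨q, h4, rfl⟩
  · exact (six_eq p).2 h5

end Summit.Ventures.Crystal3D.L2B
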